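import Mathlib
import Summits.ValiantsHypothesis.ValiantsHypothesis.Theorems.LiouvilleSarnakAlignedCutRank
import Summits.ValiantsHypothesis.ValiantsHypothesis.Theorems.LiouvilleSarnakDigitalBilinearLiouvilleRectangles
import Summits.ValiantsHypothesis.ValiantsHypothesis.Theorems.LiouvilleSarnakLiouvilleCutRankOneScaleTransfer
import HarnessLib

/-!
# Route LiouvilleSarnak — crux `LiouvilleCutRank` (stmt-ValiantsHypothesis-14775):
# MONOCHROMATIC DIGITAL RECTANGLES — the communication-complexity rung between the two cruxes

The crux asks `rank M_π ≥ W` for every balanced cut `π` at every large level `n`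
(`M_π(r,c) = λ(N_π(r,c) + 1)`, a `2^n × 2^n` matrix with entries `±1`).  The classical rectangle bound of
deterministic communication complexity, applied to `M_π`, reads:

* ★ `exists_monochromatic_rectangle` — EVERY `±1` matrix `A` on nonempty finite index sets `m, n` (over a
  field with `2 ≠ 0`) has a MONOCHROMATIC RECTANGLE `I × J` (`A` constant on it) with
  `|m| ≤ |I| · 2^{rank A}` and `|n| ≤ |J| · 2^{rank A}` — take `I` a largest class of equal rows and `J` a
  largest class of equal columns; there are at most `2^{rank}` classes of each
  (`LiouvilleSarnakAligned.card_image_row_le_two_pow_rank`), and `A` is constant on `I × J`.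
* ★ `exists_monochromatic_digitalRectangle` — hence for every cut `π` at every level `n` there are sets
  `K, K' ⊆ {0,1}^n` of row / column digit strings and a sign `s = ±1` with `λ(N_π(r,c) + 1) = s` on
  `K × K'` and `4^n ≤ |K| · |K'| · 4^{rank M_π}`; `lt_rank_add_of_monochromatic_lt` — so
  `rank M_π > n - k` as soon as every `λ`-monochromatic digital rectangle of `π` has `< 4^k` cells.
* ★★ `liouvilleCutRank_of_noLargeMonochromaticRectangle` — **NCR ⇒ crux**: if for every `D` and all large
  `n`, under every balanced cut, every `λ`-monochromatic digital rectangle `K ×_π K' ⊆ [1, 4^n]` has fewer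
  than `4^n / D` elements, then `LiouvilleCutRank`.  `liouvilleCutRank_of_noLargeMonochromaticRectangle_oneScale`
  — by the scale transfer of line `one_scale` (`OneScale.liouvilleCutRank_of_rankAtOneScale`) it even
  suffices to know this at ONE level `n₁ = n₁(D)` for each `D`.
* ★ `noLargeMonochromaticRectangle_of_digitalBilinearLiouville` — **crux `DigitalBilinearLiouville` ⇒ NCR**
  (indicator test vectors: a monochromatic rectangle has discrepancy `|K| · |K'|`, while the bilinear bound
  caps it by `ε · 4^n`; via the tree's `Rectangles.rectangles_of_digitalBilinearLiouville`), and
  `liouvilleCutRank_of_digitalBilinearLiouville'` — a second, spectral-theorem-free proof of the support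
  `BilinearImpliesCutRank`.

So the ladder reads `DigitalBilinearLiouville ⇒ NCR ⇒ LiouvilleCutRank`: the open content of the rank
crux is EXACTLY «`λ ∘ (1 + N_π)` is not constant on any digital rectangle of positive density», ONE sign
change per dense rectangle, where the bilinear crux asks for `o(1)` discrepancy on every rectangle
(`Rectangles.digitalBilinearLiouville_iff_rectangles`).  In communication language: `LiouvilleCutRank` says the
deterministic two-party complexity of `λ(1 + N)` under every balanced bit partition tends to infinity, and NCR
is the standard monochromatic-rectangle lower-bound method for it.

Honest framing: reformulation / sufficient condition; NCR is OPEN (for the aligned cut it says that the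
`√X` aligned blocks of `λ` below `X` do not agree with one sign on a fixed positive-density set of offsets for
a positive density of blocks — beyond Matomäki–Radziwiłł, which controls block MEANS); `LiouvilleCutRank`,
`DigitalBilinearLiouville`, `AlgebraicSarnak` stay OPEN, and nothing here bears on `VP ≠ VNP`.  No
definitions (NCR is written out verbatim in the theorem types).
-/

set_option linter.dupNamespace false

noncomputable section

namespace Summit.ValiantsHypothesis.ValiantsHypothesis.Theorems.LiouvilleSarnakLiouvilleCutRank.MonochromaticRectangles

open ArithmeticFunction Finset

open Summit.ValiantsHypothesis.ValiantsHypothesis.Theses.LiouvilleSarnak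
  (DigitalBilinearLiouville LiouvilleCutRank)
open Summit.ValiantsHypothesis.ValiantsHypothesis.Theorems.LiouvilleSarnakAligned
  (card_image_row_le_two_pow_rank)
open Summit.ValiantsHypothesis.ValiantsHypothesis.Theorems.LiouvilleSarnakDigitalBilinearLiouville.Rectangles
  (rectangles_of_digitalBilinearLiouville)
open Summit.ValiantsHypothesis.ValiantsHypothesis.Theorems.LiouvilleSarnakLiouvilleCutRank.OneScale
  (liouvilleCutRank_of_rankAtOneScale)

/-! ### §1 Pigeonhole and the rectangle bound for an arbitrary `±1` matrix -/

/-- **A largest fibre.**  For a map `f` on a nonempty finite type, some fibre `{a : f a = f a₀}` satisfies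
`card α ≤ #fibre · #(image f)`. [folklore] -/
theorem exists_card_le_fiber_mul_image {α β : Type*} [Fintype α] [DecidableEq β] [Nonempty α]
    (f : α → β) :
    ∃ a₀ : α, Fintype.card α ≤ (univ.filter fun a => f a = f a₀).card * (univ.image f).card := by
  classical
  have hne : (univ.image f : Finset β).Nonempty := univ_nonempty.image f
  obtain ⟨b, hb, hmax⟩ :=
    exists_max_image (univ.image f) (fun b => (univ.filter fun a : α => f a = b).card) hne
  obtain ⟨a₀, -, rfl⟩ := mem_image.mp hb
  refine ⟨a₀, ?_⟩
  have h := card_le_mul_card_image (univ : Finset α) ((univ.filter fun a : α => f a = f a₀).card)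
    (fun b hb' => hmax b hb')
  simpa [card_univ] using h

/-- ★ **The monochromatic rectangle of a `±1` matrix.**  A matrix with entries `1`, `-1` over a field with
`2 ≠ 0`, on nonempty finite index types, is constant on some rectangle `I × J` with `|m| ≤ |I| · 2^{rank}`
and `|n| ≤ |J| · 2^{rank}`: `I` a largest class of equal rows, `J` a largest class of equal columns (at most
`2^{rank}` classes of each), and for `i ∈ I`, `j ∈ J`, `A i j = A i₀ j = A i₀ j₀`.
[folklore; cf. Kushilevitz–Nisan, *Communication Complexity*, §1.4] -/
theorem exists_monochromatic_rectangle {K : Type*} [Field K] [NeZero (2 : K)] [DecidableEq K]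
    {m n : Type*} [Fintype m] [Fintype n] [DecidableEq m] [DecidableEq n] [Nonempty m] [Nonempty n]
    (A : Matrix m n K) (hA : ∀ i j, A i j = 1 ∨ A i j = -1) :
    ∃ (I : Finset m) (J : Finset n), (∃ s : K, (s = 1 ∨ s = -1) ∧ ∀ i ∈ I, ∀ j ∈ J, A i j = s) ∧
      Fintype.card m ≤ I.card * 2 ^ A.rank ∧ Fintype.card n ≤ J.card * 2 ^ A.rank := by
  classical
  obtain ⟨i₀, hi₀⟩ := exists_card_le_fiber_mul_image (fun i : m => A i)
  obtain ⟨j₀, hj₀⟩ := exists_card_le_fiber_mul_image (fun j : n => A.transpose j)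
  have hrow : (univ.image fun i : m => A i).card ≤ 2 ^ A.rank := card_image_row_le_two_pow_rank A hA
  have hcol : (univ.image fun j : n => A.transpose j).card ≤ 2 ^ A.rank := by
    have h := card_image_row_le_two_pow_rank A.transpose (fun j i => hA i j)
    rwa [Matrix.rank_transpose] at h
  refine ⟨univ.filter fun i => A i = A i₀, univ.filter fun j => A.transpose j = A.transpose j₀,
    ⟨A i₀ j₀, hA i₀ j₀, ?_⟩, ?_, ?_⟩
  · intro i hi j hj
    simp only [mem_filter, mem_univ, true_and] at hi hj
    have h1 : A i j = A i₀ j := congrFun hi j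
    have h2 : A i₀ j = A i₀ j₀ := by
      have h := congrFun hj i₀
      simpa only [Matrix.transpose_apply] using h
    rw [h1, h2]
  · exact hi₀.trans (Nat.mul_le_mul_left _ hrow)
  · exact hj₀.trans (Nat.mul_le_mul_left _ hcol)

/-! ### §2 The Liouville cut matrices -/

/-- The Liouville cut matrix `M_π(r,c) = λ(N_π(r,c) + 1)` has entries `±1`. [folklore] -/
theorem cutMatrix_entry_eq_or (n : ℕ) (π : Fin n ⊕ Fin n ≃ Fin (2 * n)) (r c : Fin n → Bool) :
    (Matrix.of fun r c : Fin n → Bool =>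
        (((liouville (Nat.ofBits (fun k : Fin (2 * n) => Sum.elim r c (π.symm k)) + 1) : ℤ) : ℂ))) r c = 1 ∨
      (Matrix.of fun r c : Fin n → Bool =>
        (((liouville (Nat.ofBits (fun k : Fin (2 * n) => Sum.elim r c (π.symm k)) + 1) : ℤ) : ℂ))) r c =
        -1 := by
  rw [Matrix.of_apply, liouville_apply (Nat.succ_ne_zero _)]
  rcases neg_one_pow_eq_or ℤ
      (cardFactors (Nat.ofBits (fun k : Fin (2 * n) => Sum.elim r c (π.symm k)) + 1)) with h | h
  · left; rw [h]; norm_num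
  · right; rw [h]; norm_num

/-- ★ **A large monochromatic digital rectangle under every cut.**  For every cut `π` of the `2n` bit
positions there are sets `K, K'` of row / column digit strings and a sign `s = ±1` such that
`λ(N_π(r,c) + 1) = s` for all `(r,c) ∈ K × K'` and `4^n ≤ |K| · |K'| · 4^{rank M_π}`. [this file] -/
theorem exists_monochromatic_digitalRectangle (n : ℕ) (π : Fin n ⊕ Fin n ≃ Fin (2 * n)) :
    ∃ (K K' : Finset (Fin n → Bool)) (s : ℤ), (s = 1 ∨ s = -1) ∧
      (∀ r ∈ K, ∀ c ∈ K',
        liouville (Nat.ofBits (fun k : Fin (2 * n) => Sum.elim r c (π.symm k)) + 1) = s) ∧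
      4 ^ n ≤ K.card * K'.card * 4 ^ (Matrix.of fun r c : Fin n → Bool =>
        (((liouville (Nat.ofBits (fun k : Fin (2 * n) => Sum.elim r c (π.symm k)) + 1) : ℤ) : ℂ))).rank := by
  classical
  set M := (Matrix.of fun r c : Fin n → Bool =>
      (((liouville (Nat.ofBits (fun k : Fin (2 * n) => Sum.elim r c (π.symm k)) + 1) : ℤ) : ℂ))) with hM
  obtain ⟨I, J, ⟨s, hs, hmono⟩, hI, hJ⟩ := exists_monochromatic_rectangle M (cutMatrix_entry_eq_or n π)
  have hcard : Fintype.card (Fin n → Bool) = 2 ^ n := by simp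
  rw [hcard] at hI hJ
  refine ⟨I, J, if s = 1 then 1 else -1, ?_, ?_, ?_⟩
  · by_cases h : s = 1
    · left; rw [if_pos h]
    · right; rw [if_neg h]
  · intro r hr c hc
    have h := hmono r hr c hc
    rw [hM, Matrix.of_apply] at h
    rcases hs with rfl | rfl
    · rw [if_pos rfl]
      exact_mod_cast h
    · rw [if_neg (by norm_num)]
      exact_mod_cast h
  · calc 4 ^ n = 2 ^ n * 2 ^ n := by rw [← mul_pow]; norm_num
      _ ≤ (I.card * 2 ^ M.rank) * (J.card * 2 ^ M.rank) := Nat.mul_le_mul hI hJ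
      _ = I.card * J.card * 4 ^ M.rank := by
          rw [show (4 : ℕ) = 2 * 2 by norm_num, mul_pow]; ring

/-- **Quantitative form.**  If under the cut `π` at level `n` every `λ`-monochromatic digital rectangle has
fewer than `4^k` cells, then `n < k + rank M_π`, i.e. `rank M_π ≥ n - k + 1`. [this file] -/
theorem lt_rank_add_of_monochromatic_lt (n k : ℕ) (π : Fin n ⊕ Fin n ≃ Fin (2 * n))
    (h : ∀ (K K' : Finset (Fin n → Bool)) (s : ℤ), (s = 1 ∨ s = -1) →
      (∀ r ∈ K, ∀ c ∈ K',
        liouville (Nat.ofBits (fun j : Fin (2 * n) => Sum.elim r c (π.symm j)) + 1) = s) →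
      K.card * K'.card < 4 ^ k) :
    n < k + (Matrix.of fun r c : Fin n → Bool =>
      (((liouville (Nat.ofBits (fun j : Fin (2 * n) => Sum.elim r c (π.symm j)) + 1) : ℤ) : ℂ))).rank := by
  obtain ⟨K, K', s, hs, hmono, hsize⟩ := exists_monochromatic_digitalRectangle n π
  have hlt := h K K' s hs hmono
  set ρ := (Matrix.of fun r c : Fin n → Bool =>
      (((liouville (Nat.ofBits (fun j : Fin (2 * n) => Sum.elim r c (π.symm j)) + 1) : ℤ) : ℂ))).rank
  have h4 : 4 ^ n < 4 ^ k * 4 ^ ρ :=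
    lt_of_le_of_lt hsize (Nat.mul_lt_mul_of_pos_right hlt (by positivity))
  rw [← pow_add] at h4
  exact (Nat.pow_lt_pow_iff_right (by norm_num)).mp h4

/-! ### §3 NCR ⇒ `LiouvilleCutRank` -/

/-- ★★ **No large monochromatic rectangles ⇒ the crux.**  If for every `D` and all large `n`, for every
balanced cut `π` of the `2n` bit positions, every `λ`-MONOCHROMATIC digital rectangle `K ×_π K'`
(`λ(N_π(r,c) + 1)` constant `= ±1` on it) satisfies `|K| · |K'| · D < 4^n`, then `LiouvilleCutRank` holds:
with `D = 4^W` the rectangle of `exists_monochromatic_digitalRectangle` gives `4^W < 4^{rank M_π}`.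
[this file] -/
theorem liouvilleCutRank_of_noLargeMonochromaticRectangle
    (h : ∀ D : ℕ, ∃ n₀ : ℕ, ∀ n ≥ n₀, ∀ π : Fin n ⊕ Fin n ≃ Fin (2 * n),
      ∀ (K K' : Finset (Fin n → Bool)) (s : ℤ), (s = 1 ∨ s = -1) →
        (∀ r ∈ K, ∀ c ∈ K',
          liouville (Nat.ofBits (fun j : Fin (2 * n) => Sum.elim r c (π.symm j)) + 1) = s) →
        K.card * K'.card * D < 4 ^ n) :
    LiouvilleCutRank := by
  intro W
  obtain ⟨n₀, hn₀⟩ := h (4 ^ W)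
  refine ⟨n₀, fun n hn π => ?_⟩
  obtain ⟨K, K', s, hs, hmono, hsize⟩ := exists_monochromatic_digitalRectangle n π
  have hlt : K.card * K'.card * 4 ^ W < K.card * K'.card * 4 ^ (Matrix.of fun r c : Fin n → Bool =>
      (((liouville (Nat.ofBits (fun j : Fin (2 * n) => Sum.elim r c (π.symm j)) + 1) : ℤ) : ℂ))).rank :=
    lt_of_lt_of_le (hn₀ n hn π K K' s hs hmono) hsize
  exact ((Nat.pow_lt_pow_iff_right (by norm_num)).mp (Nat.lt_of_mul_lt_mul_left hlt)).le

/-- **NCR at ONE level per `D` already suffices** (scale transfer of line `one_scale`,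
`OneScale.liouvilleCutRank_of_rankAtOneScale`): if for every `W` there is a level `n₁` at which, under
EVERY balanced cut, every `λ`-monochromatic digital rectangle has `|K| · |K'| · 4^W < 4^{n₁}`, then
`LiouvilleCutRank`. [this file] -/
theorem liouvilleCutRank_of_noLargeMonochromaticRectangle_oneScale
    (h : ∀ W : ℕ, ∃ n₁ : ℕ, ∀ π₁ : Fin n₁ ⊕ Fin n₁ ≃ Fin (2 * n₁),
      ∀ (K K' : Finset (Fin n₁ → Bool)) (s : ℤ), (s = 1 ∨ s = -1) →
        (∀ r ∈ K, ∀ c ∈ K',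
          liouville (Nat.ofBits (fun j : Fin (2 * n₁) => Sum.elim r c (π₁.symm j)) + 1) = s) →
        K.card * K'.card * 4 ^ W < 4 ^ n₁) :
    LiouvilleCutRank := by
  refine liouvilleCutRank_of_rankAtOneScale fun W => ?_
  obtain ⟨n₁, hn₁⟩ := h W
  refine ⟨n₁, fun π₁ => ?_⟩
  obtain ⟨K, K', s, hs, hmono, hsize⟩ := exists_monochromatic_digitalRectangle n₁ π₁
  have hlt : K.card * K'.card * 4 ^ W < K.card * K'.card * 4 ^ (Matrix.of fun r c : Fin n₁ → Bool =>
      (((liouville (Nat.ofBits (fun j : Fin (2 * n₁) => Sum.elim r c (π₁.symm j)) + 1) : ℤ) : ℂ))).rank :=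
    lt_of_lt_of_le (hn₁ π₁ K K' s hs hmono) hsize
  exact ((Nat.pow_lt_pow_iff_right (by norm_num)).mp (Nat.lt_of_mul_lt_mul_left hlt)).le

/-! ### §4 `DigitalBilinearLiouville` ⇒ NCR -/

/-- ★ **The bilinear crux implies NCR.**  Under `DigitalBilinearLiouville`, for every `D` and all large
`n`, every `λ`-monochromatic digital rectangle of every balanced cut has `|K| · |K'| · D < 4^n`: a
monochromatic rectangle has `|Σ_{K × K'} λ| = |K| · |K'|`, while the rectangle-discrepancy form of the crux
(`Rectangles.rectangles_of_digitalBilinearLiouville`) bounds this by `ε · 4^n`, `ε = 1 / (2 (D + 1))`.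
[this file] -/
theorem noLargeMonochromaticRectangle_of_digitalBilinearLiouville (h : DigitalBilinearLiouville) :
    ∀ D : ℕ, ∃ n₀ : ℕ, ∀ n ≥ n₀, ∀ π : Fin n ⊕ Fin n ≃ Fin (2 * n),
      ∀ (K K' : Finset (Fin n → Bool)) (s : ℤ), (s = 1 ∨ s = -1) →
        (∀ r ∈ K, ∀ c ∈ K',
          liouville (Nat.ofBits (fun j : Fin (2 * n) => Sum.elim r c (π.symm j)) + 1) = s) →
        K.card * K'.card * D < 4 ^ n := by
  classical
  intro D
  obtain ⟨n₀, hn₀⟩ :=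
    rectangles_of_digitalBilinearLiouville h (1 / (2 * ((D : ℝ) + 1))) (by positivity)
  refine ⟨n₀, fun n hn π K K' s hs hmono => ?_⟩
  have key := hn₀ n hn π K K'
  have hsum : ∑ r ∈ K, ∑ c ∈ K',
      ((liouville (Nat.ofBits (fun j : Fin (2 * n) => Sum.elim r c (π.symm j)) + 1) : ℤ) : ℝ) =
      (K.card : ℝ) * K'.card * s := by
    rw [sum_congr rfl fun r hr => sum_congr rfl fun c hc => by rw [hmono r hr c hc]]
    simp only [sum_const, nsmul_eq_mul]
    ring
  have habs : |(K.card : ℝ) * K'.card * s| = (K.card : ℝ) * K'.card := by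
    rcases hs with rfl | rfl
    · push_cast; rw [mul_one, abs_of_nonneg (by positivity)]
    · push_cast; rw [mul_neg_one, abs_neg, abs_of_nonneg (by positivity)]
  rw [hsum, habs] at key
  -- `|K||K'| ≤ 4^n / (2(D+1))`, so `|K||K'| D ≤ 4^n D / (2(D+1)) < 4^n`
  have h4 : (0 : ℝ) < 4 ^ n := by positivity
  have hD : (0 : ℝ) ≤ D := by positivity
  have hlt : (K.card : ℝ) * K'.card * D < 4 ^ n := by
    calc (K.card : ℝ) * K'.card * D ≤ 1 / (2 * ((D : ℝ) + 1)) * 4 ^ n * D :=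
          mul_le_mul_of_nonneg_right key hD
      _ = 4 ^ n * (D / (2 * ((D : ℝ) + 1))) := by ring
      _ < 4 ^ n * 1 := by
          refine mul_lt_mul_of_pos_left ?_ h4
          rw [div_lt_one (by positivity)]
          linarith
      _ = 4 ^ n := mul_one _
  exact_mod_cast hlt

/-- **Second proof of the support `BilinearImpliesCutRank`** (no spectral theorem):
`DigitalBilinearLiouville ⇒ NCR ⇒ LiouvilleCutRank`. [this file] -/
theorem liouvilleCutRank_of_digitalBilinearLiouville' (h : DigitalBilinearLiouville) : LiouvilleCutRank :=
  liouvilleCutRank_of_noLargeMonochromaticRectangle (noLargeMonochromaticRectangle_of_digitalBilinearLiouville h)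

end Summit.ValiantsHypothesis.ValiantsHypothesis.Theorems.LiouvilleSarnakLiouvilleCutRank.MonochromaticRectangles

end
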